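import Mathlib
import HarnessLib.Audit
import Summits.PneNP.PneNP.Theorems.PstarFreshGateTools

/-!
# Sheets of a fresh gate: substituting the gate variable (ROUND-24, memo §10.1 / §13.2, O2; targets `TerminalFiveA` / `TerminalFiveMaxSharing`)

FRONTIER range-avoidance ladder, rung F-N3, ROUND 24 (cell `pnp-ideate`, planner memo `r24/CORE-BOUND-NOTES.md` §10.1, §13.2; typed targets
`PstarCoreBoundTargets.TerminalFiveA` / `TerminalFiveMaxSharing` (p646951); restricted-model proof complexity — nothing here bears on `P` versus `NP`).

A fresh isolated gate `g₀ = (p, z)` (`PstarFreshGateTools.FreshGate`) can be SUBSTITUTED: on the SHEET `z := ζ` the reader `g₀` disappears from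
`G₁, G₂` and, if `ζ = 1`, the private `p` is toggled into the linear parts `C₁` / `C₂` of the constraints that contained `g₀` (`sheet B g₀ p ζ`).
The sheet data are ordinary bridge data with NO reader on any private — the landed hypothesis `hun` of the regime theorems
(`PstarNorUnitDirection.card_le_five`) holds on every sheet (`hun_sheet`) — and:

* `gval_sheet` — on assignments with `z = ζ` the sheet constraints take the same values as the original ones; `solution_sheet_iff`;
* `wf_sheet`, `free_sheet`, `coef_sheet_p` / `coef_sheet_of_ne` — well-formedness and the model of a sheet: same prescribed products and state-free
  parts, the gated private read with the CONSTANT coefficient `[p ∈ Cᵢ] + ζ·[g₀ ∈ Gᵢ]`, every other private as before;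
* `no_solution_sheet` — **(T3) transfers to every sheet** (a sheet solution, corrected at `z`, solves the original system);
* `solution_sheet_of_solution` — **(M0) witnesses transfer to their own sheet, and to both sheets when `p = 0`**.

Which single sheet carries ALL (M0) witnesses of a single-chord core is the subject of the sequel (the sheet lemma).
-/

set_option linter.dupNamespace false -- `Summit.PneNP.PneNP.…`: summit = sub-problem name (D-0017 single-conjunct layout)

open Finset Literature.Computability.Complexity
open scoped symmDiff
open Summit.PneNP.PneNP.Theorems.PstarFibrePolys (bit bit_xor bit_injective)
open Summit.PneNP.PneNP.Theorems.PstarTyped (Typed)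
open Summit.PneNP.PneNP.Theorems.PstarSALevel (varSet bdry BoundaryExpanding SimpleOverlap)
open Summit.PneNP.PneNP.Theorems.PstarCentreFree (vars_mem_varSet)
open Summit.PneNP.PneNP.Theorems.PstarGapOneAll (gval)
open Summit.PneNP.PneNP.Theorems.PstarGConstraint (bit_gval gval_update_of_forall_ne)
open Summit.PneNP.PneNP.Theorems.PstarGraphQuadGapTwoForms (sum_symmDiff_zmod2)
open Summit.PneNP.PneNP.Theorems.PstarXCore (xverts)
open Summit.PneNP.PneNP.Theorems.PstarReadSumset (V2)
open Summit.PneNP.PneNP.Theorems.PstarChordSystem (ChordSystem)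
open Summit.PneNP.PneNP.Theorems.PstarChordBridgeTools
open Summit.PneNP.PneNP.Theorems.PstarChordBridge
open Summit.PneNP.PneNP.Theorems.PstarFreshGateTools

namespace Summit.PneNP.PneNP.Theorems.PstarFreshGateSheet

variable {n m : ℕ}

/-! ## The sheet data -/

/-- The linear part of a constraint on the sheet `z := ζ`: toggle `p` when `ζ = 1` and the gate `g₀` belongs to the constraint. -/
def sheetC (C : Finset (Fin n)) (G : Finset (Fin m)) (g₀ : Fin m) (p : Fin n) (ζ : Bool) : Finset (Fin n) :=
  if ζ = true ∧ g₀ ∈ G then C ∆ {p} else C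

/-- **The sheet `z := ζ` of bridge data with a gate `g₀ = (p, z)`.** -/
def sheet (B : BridgeData n m) (g₀ : Fin m) (p : Fin n) (ζ : Bool) : BridgeData n m :=
  { B with C₁ := sheetC B.C₁ B.G₁ g₀ p ζ, G₁ := B.G₁.erase g₀, C₂ := sheetC B.C₂ B.G₂ g₀ p ζ, G₂ := B.G₂.erase g₀ }

/-- Membership in the sheet's linear part. -/
theorem mem_sheetC_iff {C : Finset (Fin n)} {G : Finset (Fin m)} {g₀ : Fin m} {p v : Fin n} {ζ : Bool} :
    v ∈ sheetC C G g₀ p ζ ↔ (v ∈ C ↔ ¬ (v = p ∧ ζ = true ∧ g₀ ∈ G)) := by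
  unfold sheetC
  by_cases h : ζ = true ∧ g₀ ∈ G
  · rw [if_pos h, mem_symmDiff, mem_singleton]; tauto
  · rw [if_neg h]; tauto

/-- Off `p` the sheet's linear part is the original one. -/
theorem mem_sheetC_of_ne {C : Finset (Fin n)} {G : Finset (Fin m)} {g₀ : Fin m} {p v : Fin n} (hv : v ≠ p) (ζ : Bool) :
    v ∈ sheetC C G g₀ p ζ ↔ v ∈ C := by
  rw [mem_sheetC_iff]
  simp only [hv, false_and, not_false_eq_true, iff_true]

/-- **The sheet constraints agree with the original ones on `{z = ζ}`** (the AND pair of `g₀` is `{p, z}`, `p ≠ z`). -/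
theorem gval_sheet (I : LocalMap 4 n m) (C : Finset (Fin n)) (G : Finset (Fin m)) {g₀ : Fin m} {p z : Fin n}
    (hpair : (I.vars g₀ 2 = p ∧ I.vars g₀ 3 = z) ∨ (I.vars g₀ 2 = z ∧ I.vars g₀ 3 = p)) {ζ : Bool} {zz : Fin n → Bool} (hz : zz z = ζ) :
    gval I (sheetC C G g₀ p ζ) (G.erase g₀) zz = gval I C G zz := by
  classical
  apply bit_injective
  rw [bit_gval, bit_gval]
  have hmono : bit (zz (I.vars g₀ 2)) * bit (zz (I.vars g₀ 3)) = bit (zz p) * bit ζ := by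
    rcases hpair with ⟨h2, h3⟩ | ⟨h2, h3⟩
    · rw [h2, h3, hz]
    · rw [h2, h3, hz, mul_comm]
  unfold sheetC
  by_cases hg : g₀ ∈ G
  · rw [← add_sum_erase G _ hg, hmono]
    by_cases hζ : ζ = true
    · rw [if_pos ⟨hζ, hg⟩, sum_symmDiff_zmod2, sum_singleton, hζ]
      have : bit true = 1 := rfl
      rw [this, mul_one]
      abel
    · rw [if_neg (fun h => hζ h.1)]
      have : bit ζ = 0 := by cases ζ; rfl; exact absurd rfl hζ
      rw [this, mul_zero, zero_add]
  · rw [if_neg (fun h => hg h.2), erase_eq_of_notMem hg]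

/-- Solutions on the sheet are the solutions with `z = ζ`. -/
theorem solution_sheet_iff (I : LocalMap 4 n m) (B : BridgeData n m) {g₀ : Fin m} {p z : Fin n}
    (hpair : (I.vars g₀ 2 = p ∧ I.vars g₀ 3 = z) ∨ (I.vars g₀ 2 = z ∧ I.vars g₀ 3 = p)) {ζ : Bool} {zz : Fin n → Bool} (hz : zz z = ζ)
    (K : Finset (Fin m)) : Solution I (sheet B g₀ p ζ) K zz ↔ Solution I B K zz := by
  unfold Solution
  show (∀ j ∈ K, I.eval zz j = B.y j) ∧ gval I (sheetC B.C₁ B.G₁ g₀ p ζ) (B.G₁.erase g₀) zz = B.b₁ ∧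
      gval I (sheetC B.C₂ B.G₂ g₀ p ζ) (B.G₂.erase g₀) zz = B.b₂ ↔ _
  rw [gval_sheet I B.C₁ B.G₁ hpair hz, gval_sheet I B.C₂ B.G₂ hpair hz]

/-! ## Well-formedness and the model of a sheet -/

namespace Fresh

variable {I : LocalMap 4 n m} {B : BridgeData n m} {e₀ g₀ : Fin m} {s₀ : Fin 4} {z : Fin n}

/-- **A sheet of well-formed data with a fresh gate is well formed.** -/
theorem wf_sheet (hT : Typed I) (hW : B.WF I) (h : FreshGate I B e₀ g₀ s₀ z) (ζ : Bool) : (sheet B g₀ (I.vars e₀ s₀) ζ).WF I := by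
  have hxp : ∀ w, w ∈ xverts I (B.J₀ \ B.N) → w ≠ I.vars e₀ s₀ := by
    intro w hw hwp
    unfold PstarXCore.xverts at hw
    rw [mem_biUnion] at hw
    obtain ⟨k, -, hwk⟩ := hw
    rcases (PstarXCore.mem_xpair I).1 hwk with rfl | rfl
    · exact hT k e₀ 0 s₀ (by decide) h.hs₀ hwp
    · exact hT k e₀ 1 s₀ (by decide) h.hs₀ hwp
  exact
    { hN := hW.hN
      hchord := hW.hchord
      hD := hW.hD
      hDeven := hW.hDeven
      hT₁ := hW.hT₁
      hT₂ := hW.hT₂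
      hjoin₁ := fun w => by
        show Odd (xpdeg I B.T₁ w) ↔ w ∈ sheetC B.C₁ B.G₁ g₀ (I.vars e₀ s₀) ζ ∧ w ∈ xverts I (B.J₀ \ B.N)
        rw [hW.hjoin₁ w]
        constructor
        · rintro ⟨hC, hx⟩; exact ⟨(mem_sheetC_of_ne (hxp w hx) ζ).2 hC, hx⟩
        · rintro ⟨hC, hx⟩; exact ⟨(mem_sheetC_of_ne (hxp w hx) ζ).1 hC, hx⟩
      hjoin₂ := fun w => by
        show Odd (xpdeg I B.T₂ w) ↔ w ∈ sheetC B.C₂ B.G₂ g₀ (I.vars e₀ s₀) ζ ∧ w ∈ xverts I (B.J₀ \ B.N)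
        rw [hW.hjoin₂ w]
        constructor
        · rintro ⟨hC, hx⟩; exact ⟨(mem_sheetC_of_ne (hxp w hx) ζ).2 hC, hx⟩
        · rintro ⟨hC, hx⟩; exact ⟨(mem_sheetC_of_ne (hxp w hx) ζ).1 hC, hx⟩
      hcross₁ := fun g hg => hW.hcross₁ g (mem_of_mem_erase hg)
      hcross₂ := fun g hg => hW.hcross₂ g (mem_of_mem_erase hg) }

/-- **No reader of a sheet touches a private** (the landed hypothesis `hun`). -/
theorem hun_sheet (h : FreshGate I B e₀ g₀ s₀ z) (ζ : Bool) :
    ∀ v ∈ privs I (sheet B g₀ (I.vars e₀ s₀) ζ).N,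
      (∀ g ∈ (sheet B g₀ (I.vars e₀ s₀) ζ).G₁, I.vars g 2 ≠ v ∧ I.vars g 3 ≠ v) ∧
      ∀ g ∈ (sheet B g₀ (I.vars e₀ s₀) ζ).G₂, I.vars g 2 ≠ v ∧ I.vars g 3 ≠ v := by
  intro v hv
  refine ⟨fun g hg => ?_, fun g hg => ?_⟩
  · have hg' : g ∈ B.G₁.erase g₀ := hg
    exact h.hun g (mem_union_left _ (mem_of_mem_erase hg')) (ne_of_mem_erase hg') v hv
  · have hg' : g ∈ B.G₂.erase g₀ := hg
    exact h.hun g (mem_union_right _ (mem_of_mem_erase hg')) (ne_of_mem_erase hg') v hv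

/-- The monomial outputs of a sheet lie among the original ones (for the radius bookkeeping). -/
theorem union_sheet_subset (B : BridgeData n m) (g₀ : Fin m) (p : Fin n) (ζ : Bool) :
    (sheet B g₀ p ζ).J₀ ∪ (sheet B g₀ p ζ).G₁ ∪ (sheet B g₀ p ζ).G₂ ⊆ B.J₀ ∪ B.G₁ ∪ B.G₂ := by
  show B.J₀ ∪ B.G₁.erase g₀ ∪ B.G₂.erase g₀ ⊆ B.J₀ ∪ B.G₁ ∪ B.G₂
  exact union_subset_union (union_subset_union (Subset.refl _) (erase_subset _ _)) (erase_subset _ _)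

/-- The state-free part of a constraint does not see the toggled private nor the removed private-touching reader. -/
theorem free_sheet (h : FreshGate I B e₀ g₀ s₀ z) (T : Finset (Fin m)) (C : Finset (Fin n)) (G : Finset (Fin m)) (ζ : Bool)
    (x : Fin n → ZMod 2) :
    free I B.y (B.J₀ \ B.N) B.N T (sheetC C G g₀ (I.vars e₀ s₀) ζ) (G.erase g₀) x = free I B.y (B.J₀ \ B.N) B.N T C G x := by
  unfold free
  congr 1
  · congr 1
    refine sum_congr ?_ fun _ _ => rfl
    ext v
    simp only [mem_filter]
    constructor
    · rintro ⟨hv, hx, hp⟩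
      exact ⟨(mem_sheetC_of_ne (show v ≠ I.vars e₀ s₀ from fun hvp => hp (hvp ▸ h.p_mem_privs)) ζ).1 hv, hx, hp⟩
    · rintro ⟨hv, hx, hp⟩
      exact ⟨(mem_sheetC_of_ne (show v ≠ I.vars e₀ s₀ from fun hvp => hp (hvp ▸ h.p_mem_privs)) ζ).2 hv, hx, hp⟩
  · refine sum_congr ?_ fun _ _ => rfl
    ext g
    simp only [mem_filter, mem_erase]
    constructor
    · rintro ⟨⟨-, hg⟩, hnp⟩; exact ⟨hg, hnp⟩
    · rintro ⟨hg, hnp⟩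
      refine ⟨⟨fun hgg => hnp ?_, hg⟩, hnp⟩
      subst hgg
      rcases h.hpair with ⟨h2, -⟩ | ⟨-, h3⟩
      · exact Or.inl (h2 ▸ h.p_mem_privs)
      · exact Or.inr (h3 ▸ h.p_mem_privs)

/-- The state-free parts of the sheet's model are those of the original model. -/
theorem sys_sheet_F (h : FreshGate I B e₀ g₀ s₀ z) (ζ : Bool) (x : Fin n → ZMod 2) :
    (sys I (sheet B g₀ (I.vars e₀ s₀) ζ)).F x = (sys I B).F x := by
  show ((free I B.y (B.J₀ \ B.N) B.N B.T₁ (sheetC B.C₁ B.G₁ g₀ (I.vars e₀ s₀) ζ) (B.G₁.erase g₀) x,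
      free I B.y (B.J₀ \ B.N) B.N B.T₂ (sheetC B.C₂ B.G₂ g₀ (I.vars e₀ s₀) ζ) (B.G₂.erase g₀) x) : V2) =
    (free I B.y (B.J₀ \ B.N) B.N B.T₁ B.C₁ B.G₁ x, free I B.y (B.J₀ \ B.N) B.N B.T₂ B.C₂ B.G₂ x)
  rw [free_sheet h B.T₁ B.C₁ B.G₁, free_sheet h B.T₂ B.C₂ B.G₂]

/-- The prescribed products of the sheet's model are those of the original model. -/
theorem sys_sheet_u (B : BridgeData n m) (g₀ : Fin m) (p : Fin n) (ζ : Bool) : (sys I (sheet B g₀ p ζ)).u = (sys I B).u := rfl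

/-- **The read coefficient of the gated private on a sheet is the constant `[p ∈ C] + ζ·[g₀ ∈ G]`.** -/
theorem coef_sheet_p (h : FreshGate I B e₀ g₀ s₀ z) (C : Finset (Fin n)) (G : Finset (Fin m)) (hG : G = B.G₁ ∨ G = B.G₂)
    (ζ : Bool) (x : Fin n → ZMod 2) :
    coef I (sheetC C G g₀ (I.vars e₀ s₀) ζ) (G.erase g₀) (I.vars e₀ s₀) x =
      (if I.vars e₀ s₀ ∈ C then 1 else 0) + (if g₀ ∈ G then bit ζ else 0) := by
  have hun : ∀ g ∈ G.erase g₀, I.vars g 2 ≠ I.vars e₀ s₀ ∧ I.vars g 3 ≠ I.vars e₀ s₀ := by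
    intro g hg
    have hgG : g ∈ B.G₁ ∪ B.G₂ := by
      rcases hG with rfl | rfl
      · exact mem_union_left _ (mem_of_mem_erase hg)
      · exact mem_union_right _ (mem_of_mem_erase hg)
    exact h.hun g hgG (ne_of_mem_erase hg) _ h.p_mem_privs
  rw [PstarChordBridgeForcing.coef_of_unread I hun]
  have key : I.vars e₀ s₀ ∈ sheetC C G g₀ (I.vars e₀ s₀) ζ ↔ (I.vars e₀ s₀ ∈ C ↔ ¬ (ζ = true ∧ g₀ ∈ G)) := by
    rw [mem_sheetC_iff]; simp only [true_and]
  by_cases hC : I.vars e₀ s₀ ∈ C <;> by_cases hg : g₀ ∈ G <;> cases ζ <;> (simp [key, hC, hg, bit]; try decide)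

/-- The read coefficient of any other private on a sheet is the original constant `[v ∈ C]`. -/
theorem coef_sheet_of_ne (hW : B.WF I) (h : FreshGate I B e₀ g₀ s₀ z) (C : Finset (Fin n)) (G : Finset (Fin m)) (hG : G = B.G₁ ∨ G = B.G₂)
    (ζ : Bool) {v : Fin n} (hv : v ∈ privs I B.N) (hvp : v ≠ I.vars e₀ s₀) (x : Fin n → ZMod 2) :
    coef I (sheetC C G g₀ (I.vars e₀ s₀) ζ) (G.erase g₀) v x = if v ∈ C then 1 else 0 := by
  have hun : ∀ g ∈ G.erase g₀, I.vars g 2 ≠ v ∧ I.vars g 3 ≠ v := by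
    intro g hg
    rcases hG with rfl | rfl
    · exact (h.unread_of_ne hW hv hvp).1 g (mem_of_mem_erase hg)
    · exact (h.unread_of_ne hW hv hvp).2 g (mem_of_mem_erase hg)
  rw [PstarChordBridgeForcing.coef_of_unread I hun]
  by_cases hC : v ∈ C
  · rw [if_pos hC, if_pos ((mem_sheetC_of_ne hvp ζ).2 hC)]
  · rw [if_neg hC, if_neg (fun h' => hC ((mem_sheetC_of_ne hvp ζ).1 h'))]

/-! ## (T3) and (M0) witnesses on the sheets -/

/-- Correcting an assignment at the isolated `z` does not change the sheet constraints nor the core outputs. -/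
theorem solution_update_z (hW : B.WF I) (h : FreshGate I B e₀ g₀ s₀ z) {ζ : Bool} {K : Finset (Fin m)} (hK : K ⊆ B.J₀)
    {zz : Fin n → Bool} (hzz : Solution I (sheet B g₀ (I.vars e₀ s₀) ζ) K zz) (b : Bool) :
    Solution I (sheet B g₀ (I.vars e₀ s₀) ζ) K (Function.update zz z b) := by
  obtain ⟨hK', h₁, h₂⟩ := hzz
  have hG : ∀ G : Finset (Fin m), G = B.G₁ ∨ G = B.G₂ → ∀ g ∈ G.erase g₀, I.vars g 2 ≠ z ∧ I.vars g 3 ≠ z := by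
    intro G hG g hg
    have hgG : g ∈ B.G₁ ∪ B.G₂ := by
      rcases hG with rfl | rfl
      · exact mem_union_left _ (mem_of_mem_erase hg)
      · exact mem_union_right _ (mem_of_mem_erase hg)
    exact h.hzG g hgG (ne_of_mem_erase hg)
  have hzC : ∀ C : Finset (Fin n), ∀ G : Finset (Fin m), (C = B.C₁ ∧ G = B.G₁) ∨ (C = B.C₂ ∧ G = B.G₂) →
      z ∉ sheetC C G g₀ (I.vars e₀ s₀) ζ := by
    rintro C G hCG hz
    rw [mem_sheetC_of_ne (h.p_ne_z hW).symm] at hz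
    rcases hCG with ⟨rfl, -⟩ | ⟨rfl, -⟩
    · exact h.hzC.1 hz
    · exact h.hzC.2 hz
  refine ⟨fun j hj => ?_, ?_, ?_⟩
  · rw [PstarChordRepair.eval_flip_of_not_mem I zz (h.hzJ j (hK hj))]; exact hK' j hj
  · show gval I (sheetC B.C₁ B.G₁ g₀ (I.vars e₀ s₀) ζ) (B.G₁.erase g₀) (Function.update zz z b) = B.b₁
    rw [gval_update_of_forall_ne I zz (hzC _ _ (Or.inl ⟨rfl, rfl⟩)) (hG _ (Or.inl rfl))]; exact h₁
  · show gval I (sheetC B.C₂ B.G₂ g₀ (I.vars e₀ s₀) ζ) (B.G₂.erase g₀) (Function.update zz z b) = B.b₂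
    rw [gval_update_of_forall_ne I zz (hzC _ _ (Or.inr ⟨rfl, rfl⟩)) (hG _ (Or.inr rfl))]; exact h₂

/-- **(T3) transfers to every sheet.** -/
theorem no_solution_sheet (hW : B.WF I) (h : FreshGate I B e₀ g₀ s₀ z) (hT3 : ¬ ∃ zz, Solution I B B.J₀ zz) (ζ : Bool) :
    ¬ ∃ zz, Solution I (sheet B g₀ (I.vars e₀ s₀) ζ) B.J₀ zz := by
  rintro ⟨zz, hzz⟩
  have h' := solution_update_z hW h (Subset.refl _) hzz ζ
  rw [solution_sheet_iff I B h.hpair (by rw [Function.update_self]) B.J₀] at h'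
  exact hT3 ⟨_, h'⟩

/-- **An (M0) witness transfers to its own sheet** (`z = ζ`) … -/
theorem solution_sheet_self (h : FreshGate I B e₀ g₀ s₀ z) {K : Finset (Fin m)} {zz : Fin n → Bool}
    (hzz : Solution I B K zz) : Solution I (sheet B g₀ (I.vars e₀ s₀) (zz z)) K zz :=
  (solution_sheet_iff I B h.hpair rfl K).2 hzz

/-- … **and to both sheets when the gated private is `0` there** (the gate monomial vanishes whatever `z` is). -/
theorem solution_sheet_of_p_false (hW : B.WF I) (h : FreshGate I B e₀ g₀ s₀ z) {K : Finset (Fin m)} (hK : K ⊆ B.J₀)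
    {zz : Fin n → Bool} (hzz : Solution I B K zz) (hp : zz (I.vars e₀ s₀) = false) (ζ : Bool) :
    Solution I (sheet B g₀ (I.vars e₀ s₀) ζ) K (Function.update zz z ζ) := by
  -- first move to the assignment with `z := ζ` inside the ORIGINAL system: the gate monomial is `0` either way
  have hzz' : Solution I B K (Function.update zz z ζ) := by
    obtain ⟨hK', h₁, h₂⟩ := hzz
    have hGv : ∀ C : Finset (Fin n), ∀ G : Finset (Fin m), (C = B.C₁ ∧ G = B.G₁) ∨ (C = B.C₂ ∧ G = B.G₂) →
        gval I C G (Function.update zz z ζ) = gval I C G zz := by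
      intro C G hCG
      classical
      apply bit_injective
      rw [bit_gval, bit_gval]
      have hzC : z ∉ C := by
        rcases hCG with ⟨rfl, -⟩ | ⟨rfl, -⟩
        · exact h.hzC.1
        · exact h.hzC.2
      have hGG : G ⊆ B.G₁ ∪ B.G₂ := by
        rcases hCG with ⟨-, rfl⟩ | ⟨-, rfl⟩
        · exact subset_union_left
        · exact subset_union_right
      congr 1
      · exact sum_congr rfl fun v hv => by rw [Function.update_of_ne (show v ≠ z from fun hvz => hzC (hvz ▸ hv))]
      · refine sum_congr rfl fun g hg => ?_
        by_cases hgg : g = g₀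
        · subst hgg
          have hpz := h.p_ne_z hW
          rcases h.hpair with ⟨h2, h3⟩ | ⟨h2, h3⟩
          · rw [h2, h3, Function.update_of_ne hpz, hp]; simp [bit]
          · rw [h2, h3, Function.update_of_ne hpz, hp]; simp [bit]
        · obtain ⟨h2, h3⟩ := h.hzG g (hGG hg) hgg
          rw [Function.update_of_ne h2, Function.update_of_ne h3]
    refine ⟨fun j hj => ?_, ?_, ?_⟩
    · rw [PstarChordRepair.eval_flip_of_not_mem I zz (h.hzJ j (hK hj))]; exact hK' j hj
    · rw [hGv _ _ (Or.inl ⟨rfl, rfl⟩)]; exact h₁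
    · rw [hGv _ _ (Or.inr ⟨rfl, rfl⟩)]; exact h₂
  exact (solution_sheet_iff I B h.hpair (by rw [Function.update_self]) K).2 hzz'

end Fresh

end Summit.PneNP.PneNP.Theorems.PstarFreshGateSheet
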